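import Summits.HodgeConjecture.CorCM.MumfordTateRankTypeIVTimesTwoCMCurvesCells
import Summits.HodgeConjecture.CorCM.MumfordTateRankThreefoldTimesCurves
import Summits.HodgeConjecture.CorCM.Assembly.CMEllipticCurvesIsogenyFields
import HarnessLib

/-!
# The fivefold partition {1,1,3} over a simple type-IV(2,1) threefold: `t(T × E₁ × E₂) ∈ {10, 11, 12, 13, 14, 16}` for a simple abelian
# threefold `T` with `dim_ℚ End⁰T = 2` and ARBITRARY elliptic curves `E₁, E₂`, every cell exact (Moonen–Zarhin 1999 §2–§3)

COR-CM (cell `pub-hodgecm2`, seat `b27` gen 50, count-neutral Mumford–Tate-rank ladder; theorems only, no definition, no named fact;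
UNCONDITIONAL — nothing here uses or asserts HC_CM).  Notation `t(X) = dim MT(H¹X)`; `k = End⁰T` (imaginary quadratic; `t(T) = 10`).

THE TABLE for `X ∼ T × (E₁ × E₂)`:
* both CM, `End⁰E₁ ↪ k`, `End⁰E₂ ↪ k`                                   : `10` (then `E₁ ∼ E₂`, duplicate factor; `t(E × T) = 10`, same field);
* both CM, exactly one of `End⁰E_i` maps to `k`                            : `11` (`CorCM/MumfordTateRankTypeIVTimesCMCurveRigid`);
* both CM, neither maps to `k`, `End⁰E₂ → End⁰E₁` exists (`E₁ ∼ E₂`)       : `11` (duplicate; `t(E × T) = 11`, different fields);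
* both CM, `k, End⁰E₁, End⁰E₂` pairwise without ring homomorphisms          : `12` (`CorCM/MumfordTateRankTypeIVTimesTwoCMCurvesCells`);
* `E₁` non-CM, `E₂` CM with `End⁰E₂ ↪ k` / `↛ k`                            : `13` / `14` (`+3`, Lemma (3.4));
* both non-CM, isogenous / not                                             : `13` / `16`.

* §1 `isIsogenous_of_nonempty_ringHom_of_cmCurves` (CM curves with a ring homomorphism `End⁰E₂ → End⁰E₁` are isogenous),
  `nonempty_ringHom_of_cmCurves_of_nonempty` (two CM fields mapping to `k` map to each other).
* §2 the CM × CM cells `10`, `11` (duplicate) and the assembled **`mtRank_hodge_one_mem_of_isIsogenous_typeIV_threefold_prod_cmCurves`**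
  (`t ∈ {10, 11, 12}`).
* §3 mixed and non-CM cells: `13 / 14`, `13 / 16`.
* §4 **`mtRank_hodge_one_mem_of_isIsogenous_typeIV_threefold_prod_curves`** — `t(T × E₁ × E₂) ∈ {10, 11, 12, 13, 14, 16}` for all curves.

## References
* [MoonenZarhin1999LowDim] B. Moonen, Yu. G. Zarhin, *Hodge classes on abelian varieties of low dimension*, Math. Ann. 315 (1999), §2 (2.1), (2.3),
  §3 (3.1), Lemma (3.4), (3.6), Prop. (3.8), Thm. 0.1 (4) [corpus: paper:arxiv-math_9901113 pp. 1, 5–7]. [cite: MoonenZarhin1999LowDim, §3 (3.4), (3.6) and (3.8)]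
* [SilvermanAdvancedTopics1994] J. H. Silverman, *Advanced Topics in the Arithmetic of Elliptic Curves*, II §1 Prop. 1.2 and §2.
  [cite: SilvermanAdvancedTopics1994, II §1 Prop. 1.2 and Prop. 1.4]
* [MumfordAV1970] D. Mumford, *Abelian Varieties* (1970), §19 Cor. 2 of Thm. 1. [cite: MumfordAV1970, §19 Cor. 2 of Thm. 1]
-/

noncomputable section

open CategoryTheory CategoryTheory.Limits Module

namespace Summit.HodgeConjecture.CorCM

open Literature.AlgebraicGeometry.Motives
open Literature.AlgebraicGeometry.Motives.AbelianVariety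
open Literature.AlgebraicGeometry.Motives.HodgeStructure
open Literature.AlgebraicGeometry.HodgeTheory
open Literature.AlgebraicGeometry.Milne1999 (IsOfCMType isOfCMType_iff_of_isIsogenous hom_eq_zero_of_isSimple_of_not_isIsogenous)

variable [HodgeTensorFacts.{0, 0}] {X T E₁ E₂ : AbelianVariety ℂ} {n : ℕ}

/-! ## §1 CM elliptic curves and ring homomorphisms of their fields -/

omit [HodgeTensorFacts.{0, 0}] in
/-- **CM elliptic curves with a ring homomorphism `End⁰E₂ → End⁰E₁` are isogenous** (a ring homomorphism between imaginary quadratic fields is an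
isomorphism of `ℚ`-algebras; isogeny classes of CM elliptic curves are the isomorphism classes of their CM fields).
[cite: SilvermanAdvancedTopics1994, II §1 Prop. 1.2 and Prop. 1.4] [cite: MoonenZarhin1999LowDim, §2 (2.1) (g = 1) and §3 Lemma (3.3)] -/
theorem isIsogenous_of_nonempty_ringHom_of_cmCurves (hE₁1 : E₁.dim = 1) (hE₁cm : IsOfCMType E₁) (hE₂1 : E₂.dim = 1) (hE₂cm : IsOfCMType E₂)
    (h : Nonempty (E₂.endAlgebra →+* E₁.endAlgebra)) : IsIsogenous E₁ E₂ := by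
  classical
  obtain ⟨χ₁, d₁, hd₁, hχ₁⟩ := exists_hom_comp_self_eq_neg_of_cmCurve hE₁1 hE₁cm
  obtain ⟨χ₂, d₂, hd₂, hχ₂⟩ := exists_hom_comp_self_eq_neg_of_cmCurve hE₂1 hE₂cm
  obtain ⟨f⟩ := h
  haveI : Module.Finite ℚ E₁.endAlgebra := AbelianVariety.finiteDimensional_endAlgebra_holds E₁
  haveI : Module.Finite ℚ E₂.endAlgebra := AbelianVariety.finiteDimensional_endAlgebra_holds E₂
  have h2₁ := finrank_endAlgebra_eq_two_of_cmCurve hE₁1 hE₁cm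
  have h2₂ := finrank_endAlgebra_eq_two_of_cmCurve hE₂1 hE₂cm
  haveI : Nontrivial E₁.endAlgebra := Module.nontrivial_of_finrank_pos (R := ℚ) (by rw [h2₁]; norm_num)
  letI := (PeriodCurve.isField_endAlgebra_of_dim_eq_one hE₂1).toField
  have hinj : Function.Injective f.toRatAlgHom := f.injective
  have hbij := CMQuadraticOrder.bijective_of_injective_of_finrank_eq f.toRatAlgHom hinj (by rw [h2₂, h2₁])
  exact ((PeriodCurve.isIsogenous_iff_nonempty_algEquiv_of_cm hE₂1 hE₁1 hd₂ hd₁ hχ₂ hχ₁).2 ⟨AlgEquiv.ofBijective _ hbij⟩).symm'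

omit [HodgeTensorFacts.{0, 0}] in
/-- **Two CM fields mapping to a quadratic `End⁰T` map to each other**: for a CM elliptic curve `E₁` and `T` with `dim_ℚ End⁰T = 2`, a ring
homomorphism `End⁰E₁ → End⁰T` is bijective (injective from a field, equal dimensions), so `End⁰E₂ → End⁰T` yields `End⁰E₂ → End⁰E₁`.
[cite: MumfordAV1970, §19 Cor. 2 of Thm. 1] -/
theorem nonempty_ringHom_of_cmCurves_of_nonempty (hE₁1 : E₁.dim = 1) (hE₁cm : IsOfCMType E₁) (hTE : Module.finrank ℚ T.endAlgebra = 2)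
    (h₁ : Nonempty (E₁.endAlgebra →+* T.endAlgebra)) (h₂ : Nonempty (E₂.endAlgebra →+* T.endAlgebra)) :
    Nonempty (E₂.endAlgebra →+* E₁.endAlgebra) := by
  classical
  obtain ⟨f₁⟩ := h₁
  obtain ⟨f₂⟩ := h₂
  haveI : Module.Finite ℚ E₁.endAlgebra := AbelianVariety.finiteDimensional_endAlgebra_holds E₁
  haveI : Module.Finite ℚ T.endAlgebra := AbelianVariety.finiteDimensional_endAlgebra_holds T
  have h2₁ := finrank_endAlgebra_eq_two_of_cmCurve hE₁1 hE₁cm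
  haveI : Nontrivial T.endAlgebra := Module.nontrivial_of_finrank_pos (R := ℚ) (by rw [hTE]; norm_num)
  letI := (PeriodCurve.isField_endAlgebra_of_dim_eq_one hE₁1).toField
  have hinj : Function.Injective f₁.toRatAlgHom := f₁.injective
  have hbij := CMQuadraticOrder.bijective_of_injective_of_finrank_eq f₁.toRatAlgHom hinj (by rw [hTE, h2₁])
  exact ⟨(RingEquiv.ofBijective f₁ hbij).symm.toRingHom.comp f₂⟩

/-! ## §2 Two CM curves -/

/-- **`t(T × E₁ × E₂) = 10` when both CM fields map to `End⁰T`** (`T` a simple abelian threefold with `dim_ℚ End⁰T = 2`): then `E₁ ∼ E₂`, the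
second curve is a duplicate factor (`CorCM/MumfordTateRankDuplicateFactor`), and `t(E₁ × T) = 10` (the same-field cell).
[cite: MoonenZarhin1999LowDim, Thm. 0.1 (4) and §3 (3.1)] -/
theorem mtRank_hodge_one_eq_ten_of_isIsogenous_threefold_prod_cmCurves_of_nonempty_of_nonempty (hX : IsSmoothProjective n X.X)
    (hTs : T.IsSimple) (hT3 : T.dim = 3) (hTE : Module.finrank ℚ T.endAlgebra = 2)
    (hE₁1 : E₁.dim = 1) (hE₁cm : IsOfCMType E₁) (hf₁ : Nonempty (E₁.endAlgebra →+* T.endAlgebra))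
    (hE₂1 : E₂.dim = 1) (hE₂cm : IsOfCMType E₂) (hf₂ : Nonempty (E₂.endAlgebra →+* T.endAlgebra))
    (hXP : IsIsogenous X (T.prod (E₁.prod E₂))) :
    haveI := BettiUniverse.finite hX 1
    (BettiUniverse.hodge exists_isReal_hodgeModel_holds hX 1).mtRank = 10 := by
  haveI := BettiUniverse.finite hX 1
  have h12 : IsIsogenous E₁ E₂ :=
    isIsogenous_of_nonempty_ringHom_of_cmCurves hE₁1 hE₁cm hE₂1 hE₂cm (nonempty_ringHom_of_cmCurves_of_nonempty hE₁1 hE₁cm hTE hf₁ hf₂)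
  have hY : IsSmoothProjective (T.prod E₁).dim (T.prod E₁).X := AbelianVariety.isSmoothProjective_holds
  haveI := BettiUniverse.finite hY 1
  have hXQ : IsIsogenous X ((T.prod E₁).prod E₁) :=
    (hXP.trans ((IsIsogenous.refl T).prod ((IsIsogenous.refl E₁).prod h12.symm'))).trans
      (Literature.AlgebraicGeometry.HodgeTheory.isIsogenous_prod_assoc T E₁ E₁).symm'
  have hdup := mtRank_hodge_one_eq_of_isIsogenous_prod_prod_self hX hY (by rw [dim_prod]; omega) hXQ (IsIsogenous.refl _)
  have h10 := mtRank_hodge_one_eq_ten_of_isIsogenous_cmCurve_prod_isSimple_threefold_of_nonempty_ringHom hY hE₁1 hE₁cm hTs hT3 hTE hf₁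
    (isIsogenous_prod_comm T E₁)
  omega

/-- **`t(T × E₁ × E₂) = 11` for two ISOGENOUS CM curves whose field does not map to `End⁰T`** (duplicate factor; `t(E₁ × T) = 11`, different
fields). [cite: MoonenZarhin1999LowDim, §3 (3.1) and Prop. (3.8)] -/
theorem mtRank_hodge_one_eq_eleven_of_isIsogenous_threefold_prod_cmCurves_of_isEmpty_of_isIsogenous (hX : IsSmoothProjective n X.X)
    (hTs : T.IsSimple) (hT3 : T.dim = 3) (hTE : Module.finrank ℚ T.endAlgebra = 2)
    (hE₁1 : E₁.dim = 1) (hE₁cm : IsOfCMType E₁) (hf₁ : IsEmpty (E₁.endAlgebra →+* T.endAlgebra)) (h12 : IsIsogenous E₁ E₂)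
    (hXP : IsIsogenous X (T.prod (E₁.prod E₂))) :
    haveI := BettiUniverse.finite hX 1
    (BettiUniverse.hodge exists_isReal_hodgeModel_holds hX 1).mtRank = 11 := by
  haveI := BettiUniverse.finite hX 1
  have hY : IsSmoothProjective (T.prod E₁).dim (T.prod E₁).X := AbelianVariety.isSmoothProjective_holds
  haveI := BettiUniverse.finite hY 1
  have hXQ : IsIsogenous X ((T.prod E₁).prod E₁) :=
    (hXP.trans ((IsIsogenous.refl T).prod ((IsIsogenous.refl E₁).prod h12.symm'))).trans
      (Literature.AlgebraicGeometry.HodgeTheory.isIsogenous_prod_assoc T E₁ E₁).symm'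
  have hdup := mtRank_hodge_one_eq_of_isIsogenous_prod_prod_self hX hY (by rw [dim_prod]; omega) hXQ (IsIsogenous.refl _)
  have h11 := mtRank_hodge_one_eq_eleven_of_isIsogenous_cmCurve_prod_isSimple_threefold_of_isEmpty_ringHom hY hE₁1 hE₁cm hTs hT3 hTE hf₁
    (isIsogenous_prod_comm T E₁)
  omega

/-- **Two CM curves over a simple type-IV(2,1) threefold: `t(T × E₁ × E₂) ∈ {10, 11, 12}`**, with the exact value read off the ring homomorphisms
between `End⁰E₁`, `End⁰E₂` and `k = End⁰T`: `10` iff both map to `k`; `12` iff the three fields are pairwise without ring homomorphisms;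
`11` otherwise. [cite: MoonenZarhin1999LowDim, Thm. 0.1 (4), §3 (3.1), (3.6) and (3.8)] -/
theorem mtRank_hodge_one_mem_of_isIsogenous_typeIV_threefold_prod_cmCurves (hX : IsSmoothProjective n X.X)
    (hTs : T.IsSimple) (hT3 : T.dim = 3) (hTE : Module.finrank ℚ T.endAlgebra = 2)
    (hE₁1 : E₁.dim = 1) (hE₁cm : IsOfCMType E₁) (hE₂1 : E₂.dim = 1) (hE₂cm : IsOfCMType E₂) (hXP : IsIsogenous X (T.prod (E₁.prod E₂))) :
    haveI := BettiUniverse.finite hX 1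
    (BettiUniverse.hodge exists_isReal_hodgeModel_holds hX 1).mtRank ∈ ({10, 11, 12} : Finset ℕ) := by
  haveI := BettiUniverse.finite hX 1
  simp only [Finset.mem_insert, Finset.mem_singleton]
  have hXP' : IsIsogenous X (T.prod (E₂.prod E₁)) := hXP.trans ((IsIsogenous.refl T).prod (isIsogenous_prod_comm E₁ E₂))
  by_cases h₁ : Nonempty (E₁.endAlgebra →+* T.endAlgebra)
  · by_cases h₂ : Nonempty (E₂.endAlgebra →+* T.endAlgebra)
    · exact Or.inl (mtRank_hodge_one_eq_ten_of_isIsogenous_threefold_prod_cmCurves_of_nonempty_of_nonempty hX hTs hT3 hTE hE₁1 hE₁cm h₁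
        hE₂1 hE₂cm h₂ hXP)
    · rw [not_nonempty_iff] at h₂
      exact Or.inr (Or.inl (mtRank_hodge_one_eq_eleven_of_isIsogenous_threefold_prod_cmCurves_of_isEmpty_of_nonempty hX hTs hT3 hTE hE₂1
        hE₂cm h₂ hE₁1 hE₁cm h₁ hXP'))
  · rw [not_nonempty_iff] at h₁
    by_cases h₂ : Nonempty (E₂.endAlgebra →+* T.endAlgebra)
    · exact Or.inr (Or.inl (mtRank_hodge_one_eq_eleven_of_isIsogenous_threefold_prod_cmCurves_of_isEmpty_of_nonempty hX hTs hT3 hTE hE₁1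
        hE₁cm h₁ hE₂1 hE₂cm h₂ hXP))
    · rw [not_nonempty_iff] at h₂
      by_cases h₃ : Nonempty (E₂.endAlgebra →+* E₁.endAlgebra)
      · exact Or.inr (Or.inl (mtRank_hodge_one_eq_eleven_of_isIsogenous_threefold_prod_cmCurves_of_isEmpty_of_isIsogenous hX hTs hT3 hTE
          hE₁1 hE₁cm h₁ (isIsogenous_of_nonempty_ringHom_of_cmCurves hE₁1 hE₁cm hE₂1 hE₂cm h₃) hXP))
      · rw [not_nonempty_iff] at h₃
        exact Or.inr (Or.inr (mtRank_hodge_one_eq_twelve_of_isIsogenous_threefold_prod_cmCurves_of_isEmpty hX hTs hT3 hTE hE₁1 hE₁cm h₁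
          hE₂1 hE₂cm h₂ h₃ hXP))

/-! ## §3 A non-CM curve and a CM curve; two non-CM curves -/

/-- **`t(T × E₁ × E₂) = t(E₂ × T) + 3` for a non-CM curve `E₁` and a CM curve `E₂`** (`T` simple of dimension `3`): `Hom(T × E₂, E₁) = 0` and Lemma (3.4);
hence `13` if `End⁰E₂ ↪ End⁰T`, `14` if not (`dim_ℚ End⁰T = 2`). [cite: MoonenZarhin1999LowDim, §3 Lemma (3.4) and Prop. (3.8)] -/
theorem mtRank_hodge_one_of_isIsogenous_threefold_prod_nonCMCurve_prod_cmCurve (hX : IsSmoothProjective n X.X)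
    (hTs : T.IsSimple) (hT3 : T.dim = 3) (hTE : Module.finrank ℚ T.endAlgebra = 2)
    (hE₁1 : E₁.dim = 1) (hE₁cm : ¬ IsOfCMType E₁) (hE₂1 : E₂.dim = 1) (hE₂cm : IsOfCMType E₂) (hXP : IsIsogenous X (T.prod (E₁.prod E₂))) :
    haveI := BettiUniverse.finite hX 1
    (Nonempty (E₂.endAlgebra →+* T.endAlgebra) ∧ (BettiUniverse.hodge exists_isReal_hodgeModel_holds hX 1).mtRank = 13) ∨
      (IsEmpty (E₂.endAlgebra →+* T.endAlgebra) ∧ (BettiUniverse.hodge exists_isReal_hodgeModel_holds hX 1).mtRank = 14) := by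
  haveI := BettiUniverse.finite hX 1
  have hY : IsSmoothProjective (E₂.prod T).dim (E₂.prod T).X := AbelianVariety.isSmoothProjective_holds
  haveI := BettiUniverse.finite hY 1
  have hXQ : IsIsogenous X (E₁.prod (E₂.prod T)) :=
    (hXP.trans (Literature.AlgebraicGeometry.HodgeTheory.isIsogenous_prod_assoc T E₁ E₂).symm').trans
      (((isIsogenous_prod_comm T E₁).prod (IsIsogenous.refl E₂)).trans
        ((Literature.AlgebraicGeometry.HodgeTheory.isIsogenous_prod_assoc E₁ T E₂).trans
          ((IsIsogenous.refl E₁).prod (isIsogenous_prod_comm T E₂))))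
  have hYE : ∀ w : E₂.prod T ⟶ E₁, w = 0 :=
    forall_hom_prod_eq_zero
      (fun v => hom_eq_zero_of_isSimple_of_not_isIsogenous (isSimple_of_dim_le_one hE₂1.le) (isSimple_of_dim_le_one hE₁1.le)
        (fun h => hE₁cm ((isOfCMType_iff_of_isIsogenous h).1 hE₂cm)) v)
      (hom_eq_zero_of_isSimple_of_dim_ne hTs (isSimple_of_dim_le_one hE₁1.le) (by omega))
  have h3 := mtRank_hodge_one_eq_add_three_of_isIsogenous_nonCMCurve_prod hX hY (by rw [dim_prod]; omega) hE₁1 hE₁cm hYE hXQ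
  by_cases hf : Nonempty (E₂.endAlgebra →+* T.endAlgebra)
  · have h10 := mtRank_hodge_one_eq_ten_of_isIsogenous_cmCurve_prod_isSimple_threefold_of_nonempty_ringHom hY hE₂1 hE₂cm hTs hT3 hTE hf
      (IsIsogenous.refl _)
    exact Or.inl ⟨hf, by omega⟩
  · rw [not_nonempty_iff] at hf
    have h11 := mtRank_hodge_one_eq_eleven_of_isIsogenous_cmCurve_prod_isSimple_threefold_of_isEmpty_ringHom hY hE₂1 hE₂cm hTs hT3 hTE hf
      (IsIsogenous.refl _)
    exact Or.inr ⟨hf, by omega⟩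

/-- **Two non-CM curves: `t(T × E₁ × E₂) = 13` if `E₁ ∼ E₂`, `16` if not** (`T` simple abelian threefold with `dim_ℚ End⁰T = 2`, `t(T) = 10`;
`+3` per isogeny class of non-CM curves, Lemma (3.4) / Prop. (3.8)). [cite: MoonenZarhin1999LowDim, §3 Lemma (3.4) and Prop. (3.8)] -/
theorem mtRank_hodge_one_of_isIsogenous_threefold_prod_nonCMCurves (hX : IsSmoothProjective n X.X)
    (hTs : T.IsSimple) (hT3 : T.dim = 3) (hTE : Module.finrank ℚ T.endAlgebra = 2)
    (hE₁1 : E₁.dim = 1) (hE₁cm : ¬ IsOfCMType E₁) (hE₂1 : E₂.dim = 1) (hE₂cm : ¬ IsOfCMType E₂) (hXP : IsIsogenous X (T.prod (E₁.prod E₂))) :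
    haveI := BettiUniverse.finite hX 1
    (IsIsogenous E₁ E₂ ∧ (BettiUniverse.hodge exists_isReal_hodgeModel_holds hX 1).mtRank = 13) ∨
      (¬ IsIsogenous E₁ E₂ ∧ (BettiUniverse.hodge exists_isReal_hodgeModel_holds hX 1).mtRank = 16) := by
  haveI := BettiUniverse.finite hX 1
  have hT : IsSmoothProjective T.dim T.X := AbelianVariety.isSmoothProjective_holds
  have hY : IsSmoothProjective (E₂.prod T).dim (E₂.prod T).X := AbelianVariety.isSmoothProjective_holds
  haveI := BettiUniverse.finite hT 1
  haveI := BettiUniverse.finite hY 1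
  have h10 : (BettiUniverse.hodge exists_isReal_hodgeModel_holds hT 1).mtRank = 10 :=
    (mtRank_hodge_one_of_isSimple_threefold_of_finrank_endAlgebra_eq_two hT hTs hT3 hTE).1
  have hTE₁ : ∀ u : T ⟶ E₁, u = 0 := hom_eq_zero_of_isSimple_of_dim_ne hTs (isSimple_of_dim_le_one hE₁1.le) (by omega)
  have hTE₂ : ∀ u : T ⟶ E₂, u = 0 := hom_eq_zero_of_isSimple_of_dim_ne hTs (isSimple_of_dim_le_one hE₂1.le) (by omega)
  have h13 : (BettiUniverse.hodge exists_isReal_hodgeModel_holds hY 1).mtRank = 13 := by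
    have h := mtRank_hodge_one_eq_add_three_of_isIsogenous_nonCMCurve_prod hY hT (by omega) hE₂1 hE₂cm hTE₂ (IsIsogenous.refl _)
    omega
  by_cases h12 : IsIsogenous E₁ E₂
  · -- duplicate factor: `X ∼ (T × E₂) × E₂`, `t(T × E₂) = t(E₂ × T) = 13`
    have hZ : IsSmoothProjective (T.prod E₂).dim (T.prod E₂).X := AbelianVariety.isSmoothProjective_holds
    haveI := BettiUniverse.finite hZ 1
    have hXQ : IsIsogenous X ((T.prod E₂).prod E₂) :=
      (hXP.trans ((IsIsogenous.refl T).prod (h12.prod (IsIsogenous.refl E₂)))).trans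
        (Literature.AlgebraicGeometry.HodgeTheory.isIsogenous_prod_assoc T E₂ E₂).symm'
    have hdup := mtRank_hodge_one_eq_of_isIsogenous_prod_prod_self hX hY (by rw [dim_prod]; omega) hXQ (isIsogenous_prod_comm E₂ T)
    exact Or.inl ⟨h12, by omega⟩
  · -- a new class: `Hom(E₂ × T, E₁) = 0`, `+3`
    have hXQ : IsIsogenous X (E₁.prod (E₂.prod T)) :=
      (hXP.trans (Literature.AlgebraicGeometry.HodgeTheory.isIsogenous_prod_assoc T E₁ E₂).symm').trans
        (((isIsogenous_prod_comm T E₁).prod (IsIsogenous.refl E₂)).trans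
          ((Literature.AlgebraicGeometry.HodgeTheory.isIsogenous_prod_assoc E₁ T E₂).trans
            ((IsIsogenous.refl E₁).prod (isIsogenous_prod_comm T E₂))))
    have hYE : ∀ w : E₂.prod T ⟶ E₁, w = 0 :=
      forall_hom_prod_eq_zero
        (fun v => hom_eq_zero_of_isSimple_of_not_isIsogenous (isSimple_of_dim_le_one hE₂1.le) (isSimple_of_dim_le_one hE₁1.le)
          (fun h => h12 h.symm') v) hTE₁
    have h3 := mtRank_hodge_one_eq_add_three_of_isIsogenous_nonCMCurve_prod hX hY (by rw [dim_prod]; omega) hE₁1 hE₁cm hYE hXQ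
    exact Or.inr ⟨h12, by omega⟩

/-! ## §4 The assembled table -/

/-- **The fivefold partition {1,1,3} over a simple type-IV(2,1) threefold: `t(T × E₁ × E₂) ∈ {10, 11, 12, 13, 14, 16}` for a simple abelian
threefold `T` with `dim_ℚ End⁰T = 2` and ARBITRARY elliptic curves `E₁`, `E₂`** — every value attained according to the table in the header
(`Hg(T) = U(2,1)`; a CM curve adds `0` or `1` by its field, a non-CM curve adds `3` per isogeny class).  With the totally real rows of
`CorCM/MumfordTateRankThreefoldTimesCurves` only the CM threefolds remain in this partition. [cite: MoonenZarhin1999LowDim, §2 (2.3), §3 (3.1), (3.4), (3.6) and (3.8)] -/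
theorem mtRank_hodge_one_mem_of_isIsogenous_typeIV_threefold_prod_curves (hX : IsSmoothProjective n X.X)
    (hTs : T.IsSimple) (hT3 : T.dim = 3) (hTE : Module.finrank ℚ T.endAlgebra = 2) (hE₁1 : E₁.dim = 1) (hE₂1 : E₂.dim = 1)
    (hXP : IsIsogenous X (T.prod (E₁.prod E₂))) :
    haveI := BettiUniverse.finite hX 1
    (BettiUniverse.hodge exists_isReal_hodgeModel_holds hX 1).mtRank ∈ ({10, 11, 12, 13, 14, 16} : Finset ℕ) := by
  haveI := BettiUniverse.finite hX 1
  have hXP' : IsIsogenous X (T.prod (E₂.prod E₁)) := hXP.trans ((IsIsogenous.refl T).prod (isIsogenous_prod_comm E₁ E₂))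
  by_cases hc₁ : IsOfCMType E₁
  · by_cases hc₂ : IsOfCMType E₂
    · have h := mtRank_hodge_one_mem_of_isIsogenous_typeIV_threefold_prod_cmCurves hX hTs hT3 hTE hE₁1 hc₁ hE₂1 hc₂ hXP
      simp only [Finset.mem_insert, Finset.mem_singleton] at h ⊢
      omega
    · simp only [Finset.mem_insert, Finset.mem_singleton]
      rcases mtRank_hodge_one_of_isIsogenous_threefold_prod_nonCMCurve_prod_cmCurve hX hTs hT3 hTE hE₂1 hc₂ hE₁1 hc₁ hXP' with
        ⟨-, h⟩ | ⟨-, h⟩ <;> omega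
  · simp only [Finset.mem_insert, Finset.mem_singleton]
    by_cases hc₂ : IsOfCMType E₂
    · rcases mtRank_hodge_one_of_isIsogenous_threefold_prod_nonCMCurve_prod_cmCurve hX hTs hT3 hTE hE₁1 hc₁ hE₂1 hc₂ hXP with
        ⟨-, h⟩ | ⟨-, h⟩ <;> omega
    · rcases mtRank_hodge_one_of_isIsogenous_threefold_prod_nonCMCurves hX hTs hT3 hTE hE₁1 hc₁ hE₂1 hc₂ hXP with ⟨-, h⟩ | ⟨-, h⟩ <;> omega

end Summit.HodgeConjecture.CorCM

end
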